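import Literature.MathematicalPhysics.QuantumFieldTheory.Balaban1983to89.B9Thm314HFlatV1Transfer
import Literature.MathematicalPhysics.QuantumFieldTheory.Balaban1983to89.B9Thm314QGQInvFlatV1MultiLevelTorus
import Literature.MathematicalPhysics.QuantumFieldTheory.Balaban1983to89.B6Cor28EntriesKLevelV1

/-!
# `Balaban1983to89.B9Thm314HFlatV1MultiLevelTorus` — [B9] THEOREM 3.14 (pp. 426–427, (3.154)) AT `U = 1` FOR THE GENUINE `k`-LEVEL
`H = GQ*(QGQ*)⁻¹ = GE ∘ QsE ∘ EE (domT hN D hk)` ON THE V1 TORUS, FILE H2 OF 2: THE UNCONDITIONAL THEOREM — for two nested families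
`{Ω_j}`, `{Ω′_j}` on one torus, every fine bond `f` of `Ω = Ω_k ∩ Ω′_k`, every common top index bond `c` and every direction `ν`,
`|(H[Ω]e_c)(f) − (H[Ω′]e_c̃)(f)| ≤ C·e^{−δ·min(d_T(y(f),βc), d_T′(y′(f),β′c̃))}·e^{−δ·d(y(f), βc, Ω)}` and
`|(∇_νH[Ω]e_c)(f) − (∇_νH[Ω′]e_c̃)(f)| ≤ C·(L^{j(y(f))}·|c_f|⁻¹)⁻¹·e^{−δ·min(…)}·e^{−δ·d(y(f), βc, Ω)}` — BOTH entries (2.151)₁,₂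
(instantiation of the generic-left-factor engine `B9Thm314HFlatV1Transfer.thm314_TH_of_hyps` at `T = G` and `T = ∇_νG`; theorems only;
no existing module is touched; no fact is minted)

HEADER.  Unit `lit-balaban-p21` (literature-prover, Phase-2 proof seat), GENERATION 24, 2026-08-25; referee-facing records under
`run/shared/lean/pub/lit-balaban/`.  T. Bałaban, *Propagators for lattice gauge theories in a background field*, Commun. Math.
Phys. **99** (1985) 389–434 [Balaban1985BackgroundPropagators] = [B9], Sect. D, Theorem 3.14; [4] = T. Bałaban, *Propagators and
renormalization transformations for lattice gauge theories. II*, Commun. Math. Phys. **96** (1984) 223–250 [Balaban1984PropagatorsII],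
Corollary 2.8 (2.150)–(2.151) p. 249.

FRAMING (verbatim cell line): statement-level skeleton of published theorems with citation tags; proofs where landed; nothing
here is a claim about the Yang–Mills mass gap.

SKELETON ROW: B9.Thm3.14 (owner r06) × B6.Cor2.8 (owner r03), cross-reference cells only: the `H`-instance of Theorem 3.14 at `U = 1`
on the genuine `k`-level V1 torus.  Inputs BY NAME (nothing restated): r03's `B6Cor28EntriesKLevelV1.cor28_kLevel_H_DH` ((2.151)₁,₂ at k
levels), `B6QGQCoerciveKLevelV1.prop27_kLevel_unconditional` ((2.149)), p38's `B6Prop26GradKLevelV1.prop26_2136_grad_kLevel_unconditional_pad_V1`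
((2.136)₁,₂), this seat's `B9Thm314GFlatV1Transfer.thm314_G_flat_V1` / `thm314_gradG_flat_V1` (Theorem 3.14 for `G`, `∇G`),
`B9Thm314QGQInvFlatV1MultiLevelTorus.thm314_QGQinv_flat_V1` (Theorem 3.14 for `(QGQ*)⁻¹`), `B9Thm314GpFlatMultiLevelTorus.consts_260_261`,
r03's `B6Cor28KLevelV1.absorb_threshold`.

WHAT IS PRINTED.  [B9] p. 426: «Let us take localizations determined by points y, y′ ∈ Ω^{(k)} (i.e. these are cubes Δ(y), Δ(y′) in
the case of operators G′, G, G₁, 𝔊, the cube Δ(y) and the point y′ in the case of H, H₁, and the points y, y′ in the case of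
(Q′G′²Q′*)⁻¹, (QGQ*)⁻¹, etc.).»; p. 427: «**Theorem 3.14.** If we take a pair of operators constructed for the two sequences {Ω_j},
{Ω′_j}, then their difference satisfies all the inequalities characteristic for operators of the considered type, with the additional
factor exp(−δ₀d(y, y′, Ω)), d(y, y′, Ω) = inf_{y₁∈Ωᶜ∩T^{(k)}}(|y − y₁| + |y₁ − y′|) (3.154) on the right-hand sides.»  [4] p. 249: «A kernel of the
operator H, (HB)(b) = Σ_{c∈𝔅}(L^{j(c)}η)^d H(b, c)B(c), (2.150) satisfies the inequality |H(b, c)|, |(∇H)(b, c)|, ‖(ζ∇H)(·, c)‖_α ≤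
O(1)[1, (L^jη)^{−1}, (L^jη)^{−1−α}(‖ζ‖_α + |ζ|)](L^{j′}η)^{−d}e^{−δ₅d(y,c₋)}, (1.151) b ∈ Δ(y) or supp ζ ⊂ Δ(y), y ∈ Λ_j, c₋ ∈ Λ_{j′}.»;
«**Proposition 2.7.** The operator (QGQ*)⁻¹ is given by the convergent expansions of the form (2.86), and it satisfies the bound
|(QGQ*)⁻¹(b, b′)| ≤ O(1)(L^jη)^{−2}(L^{j′}η)^{−d}e^{−½δ₄d(b,b′)}, b ∈ Λ_j, b′ ∈ Λ_{j′}. (2.149)».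

## WHAT THIS FILE CERTIFIES (kernel-checked, sorry-free, standard axioms; lattice units, `D = d + 1`, `L = ℓ + 1`; THEOREMS ONLY)

* §1 reshaping one-family inputs to a common rate (`inner_weaken`, `hasMajorant_weaken`; `exp_weaken` is file Q3's), the operator identity
  `∇_ν ∘ (G ∘ Q*(QGQ*)⁻¹) = (∇_ν ∘ G) ∘ Q*(QGQ*)⁻¹` (`gradH_apply_eq_comp`), the output factor `pref(y) = (L^{j(y)}|c_f|⁻¹)²`
  (`pref_eq_len_sq`);
* §2 **`thm314_H_flat_V1`**: there are `δ, C, M₀ > 0` and `N₀` (depending on `d, L, b₀, b₁` only) such that for every V1 torus,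
  every two nested families `D, D′` with `k ≥ 2` levels and the ROUTE-V side conditions (`M_h = L^a ≥ 8`, `R ≥ 2L²`, `P′ ≥ 5L`,
  `L ≥ 5` odd, placed cubes, `M₀ ≤ L·M_h`, `N₀ + 1 ≤ R·L·M_h`), every `c_f ≠ 0`, band weights agreeing on the common index pairs, every
  fine bond `f` with both levels `= k` at its site, every common top index bond `c` (twin `c̃`) and every direction `ν`:
  `|(H[Ω]e_c)(f) − (H[Ω′]e_c̃)(f)| ≤ C·e^{−δ·min(d_T(y(f), βc), d_T′(y′(f), β′c̃))}·e^{−δ·d(y(f), βc, Ω)}` AND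
  `|(∇_νH[Ω]e_c)(f) − (∇_νH[Ω′]e_c̃)(f)| ≤ C·(L^{j(y(f))}·|c_f|⁻¹)⁻¹·e^{−δ·min(d_T(y(f), βc), d_T′(y′(f), β′c̃))}·e^{−δ·d(y(f), βc, Ω)}`.

## HONEST SCOPE

(1) `U = 1` only; V1 torus lineage; the ENTRIES `|H(b, c)|`, `|(∇H)(b, c)|` of (2.151) (no Hölder quotient `‖(ζ∇H)(·, c)‖_α` — the
k-level two-family (2.137) input is not in the tree in the needed form); fine bonds of `Ω` and COMMON TOP index bonds only (print's
«y, y′ ∈ Ω^{(k)}»); `∇_ν = B6GradLegKLevelV1.DV ν c_f` (r03's k-level gradient leg, as in `cor28_kLevel_H_DH`).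
(2) The output has NO level factor: print's `(L^{j′}η)^{−d}` of (2.150)–(2.151) is the normalisation of the sum `Σ_c (L^{j(c)}η)^d H(b,c)B(c)`,
absorbed here in the flat `ℓ²(𝔅)` entries exactly as in r03's `cor28_kLevel_H_DH` (whose one-family bounds `C·[1, (L^jη)^{−1}]·e^{−δ₅d_T}` are
the «inequalities characteristic for operators of the considered type»).  (3) The decay is `e^{−δ·min(d_T, d_T′)}` in the two families' (2.46)
torus graph distances (the geometric mean of the `Ω`-bound with the trivial bound), (3.154) as in `B9Thm314GpFlatTorusGeometry`;
constants existential, ours, not optimised.  (4) The expansion form of `H` is not re-derived (route declared in file H1: the transfer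
identity replaces the walk cancellation).  NOT summit progress.

v1.1 (doc-only, D-g110-2 of ref-4 gen 110): the (3.154) display in the Theorem 3.14 quotation above now reads verbatim «d(y, y′, Ω) = inf_{y₁∈Ωᶜ∩T^{(k)}}(|y − y₁| + |y₁ − y′|)» (v1.0 had «inf_{x∈Ωᶜ}(|y − x| + |x − y′|)»); declarations byte-identical.
-/

noncomputable section

open scoped BigOperators InnerProductSpace
open Finset

namespace Literature.MathematicalPhysics.QuantumFieldTheory.Balaban1983to89.B9Thm314HFlatV1MultiLevelTorus

open B4Reflection242 (boxDom blk)
open B6MultiLevelBoxOperator (N0)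
open B6MultiLevelTorusOperator (TDomains)
open B6Geom246MultiLevelBox (bset blkOf)
open B6Geom246MultiLevelTorus (geomT)
open B6SectAOperatorsV1 (QE QsE BondIdx BondIdxSpace)
open B6SectAVectorModelV1 (GE EE)
open B6GlobalChartV1 (PV toBox domT blkV1)
open B6Ineq2142KLevelV1 (lvl β)
open B6Prop27KLevelV1 (wt lam lam_pos rho rho_isPseudoDist)
open B6QGQCoerciveKLevelV1 (gam0 gam0_pos prop27_kLevel_unconditional)
open B6RandomWalk (HasMajorant BlockSupp hasMajorant_mono delta3 delta3_pos)
open B6Ineq2133TwoScaleV1 (onFun)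
open B6Prop26KLevelSkeletonV1 (pref pref_nonneg)
open B6Prop26KLevelAssemblyV1 (distT_nonneg)
open B6Prop26GradKLevelV1 (prop26_2136_grad_kLevel_unconditional_pad_V1)
open B6GradLegKLevelV1 (DV)
open B6Lemma21Repaired (Ineq261With)
open B6Cover236MultiLevelBlocks (cubes)
open B6CubeWindowV1 (Placed GlobalBand)
open B6Cor28KLevelV1 (absorb_threshold two_le_RMh onFun_comp pref_pos)
open B6Cor28EntriesKLevelV1 (cor28_kLevel_H_DH)
open B8Ineq192MultiLevelTorus (geomT_len)
open B9Thm314GpFlatTorusGeometry (dOmega dOmega_nonneg)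
open B9Thm314GpFlatMultiLevelTorus (consts_260_261)
open B9Thm314GFlatV1Kernel (IsCT)
open B9Thm314GFlatV1Transfer (thm314_G_flat_V1 thm314_gradG_flat_V1)
open B9Thm314QGQInvFlatV1MultiLevelTorus (thm314_QGQinv_flat_V1 exp_weaken)
open B9Thm314HFlatV1Transfer (thm314_TH_of_hyps H_apply_eq_comp blkV1_common_top)

variable {d ℓ m K : ℕ} {hd : 1 ≤ d + 1} {hL : Odd (ℓ + 1) ∧ 1 < ℓ + 1}
variable {Mh k R : ℕ} {P' : Fin (d + 1) → ℕ}

/-! ## §1  Reshaping the one-family inputs to a common rate; the operator identity for `∇H`; the output factor -/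

section Inputs

/-- lowering the rate of a (2.149)-type entry bound `≤ Λ_a⁻¹Λ_b⁻¹·(S·e^{−δ′ρ})`. [cite: Balaban1984PropagatorsII, Prop. 2.7 (2.149) p.249, bookkeeping] -/
theorem inner_weaken {x la lb S δ δ' ρ : ℝ} (hla : 0 ≤ la) (hlb : 0 ≤ lb) (hS : 0 ≤ S) (h : δ ≤ δ') (hρ : 0 ≤ ρ)
    (hx : |x| ≤ la * lb * (S * Real.exp (-(δ' * ρ)))) : |x| ≤ la * lb * (S * Real.exp (-(δ * ρ))) :=
  hx.trans (mul_le_mul_of_nonneg_left (mul_le_mul_of_nonneg_left (exp_weaken h hρ) hS) (mul_nonneg hla hlb))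

/-- lowering the rate and enlarging the constant of a two-family bound `≤ C·W·e^{−δ′m}·e^{−δ′dΩ}`.
[cite: Balaban1985BackgroundPropagators, Thm 3.14 (3.154) p.427, bookkeeping] -/
theorem twoFamily_weaken {x C C' W δ δ' mn dΩ : ℝ} (hC : C ≤ C') (hC' : 0 ≤ C') (hW : 0 ≤ W) (h : δ ≤ δ') (hm : 0 ≤ mn) (hd : 0 ≤ dΩ)
    (hx : |x| ≤ C * W * Real.exp (-(δ' * mn)) * Real.exp (-(δ' * dΩ))) :
    |x| ≤ C' * W * Real.exp (-(δ * mn)) * Real.exp (-(δ * dΩ)) := by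
  refine hx.trans ?_
  have hF : 0 ≤ C' * W := mul_nonneg hC' hW
  exact mul_le_mul (mul_le_mul (mul_le_mul_of_nonneg_right hC hW) (exp_weaken h hm) (Real.exp_pos _).le hF)
    (exp_weaken h hd) (Real.exp_pos _).le (mul_nonneg hF (Real.exp_pos _).le)

variable (hN : ∀ μ, N0 ℓ Mh k P' μ = (PV d ℓ m K hd hL).sitesPerDir 0) (D₀ : TDomains d ℓ Mh k P' R) (hk : k ≤ m + K)
variable {cf : ℝ} (hcf : cf ≠ 0) {w : BondIdx (domT hN D₀ hk) → ℝ} (hw : ∀ i, 0 < w i)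

/-- lowering the rate of a (2.136)-type majorant `F·e^{−δ′d_T}` (r03's `hasMajorant_mono`). [cite: Balaban1984PropagatorsII, (2.136) p.247, bookkeeping] -/
theorem hasMajorant_weaken {T : Module.End ℝ (PBond (PV d ℓ m K hd hL) 0 → ℝ)} {F : ↥(bset D₀.toDomains) → ℝ} {δ δ' : ℝ}
    (hF : ∀ y, 0 ≤ F y) (h : δ ≤ δ')
    (hT : HasMajorant (g := geomT D₀) (blkV1 hN D₀) T (fun y y' => F y * Real.exp (-(δ' * (geomT D₀).dist y y')))) :
    HasMajorant (g := geomT D₀) (blkV1 hN D₀) T (fun y y' => F y * Real.exp (-(δ * (geomT D₀).dist y y'))) :=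
  hasMajorant_mono (g := geomT D₀) (blkV1 hN D₀) hT fun y y' =>
    mul_le_mul_of_nonneg_left (exp_weaken h (distT_nonneg (D := D₀) y y')) (hF y)

/-- `∇_νH = ∇_ν ∘ G ∘ Q*(QGQ*)⁻¹` is the instance `T = ∇_νG` of the engine: `(∇_ν ∘ (G ∘ Q*E))e_c = ((∇_ν ∘ G) ∘ Q*E)e_c`.
[cite: Balaban1984PropagatorsII, (2.130) p.246, (2.150)–(2.151) p.249, dictionary] -/
theorem gradH_apply_eq_comp (ν : Fin (d + 1)) (c : BondIdx (domT hN D₀ hk)) (f : PBond (PV d ℓ m K hd hL) 0) :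
    (DV ν cf ∘ₗ onFun (GE (domT hN D₀ hk) hcf hw ∘ₗ QsE (domT hN D₀ hk) ∘ₗ EE (domT hN D₀ hk) hcf hw)) (Pi.single c 1) f
      = ((DV ν cf ∘ₗ onFun (GE (domT hN D₀ hk) hcf hw)) ∘ₗ onFun (QsE (domT hN D₀ hk) ∘ₗ EE (domT hN D₀ hk) hcf hw))
          (Pi.single c 1) f := by
  rw [onFun_comp, LinearMap.comp_assoc]

/-- the output factor of a block is the square of print's `L^{j(y)}η·|c_f|⁻¹`: `pref(y) = (len(y)·|c_f|⁻¹)²`.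
[cite: Balaban1984PropagatorsII, (2.136) p.247, (2.151) p.249, dictionary] -/
theorem pref_eq_len_sq (cf : ℝ) (y : ↥(bset D₀.toDomains)) : pref cf y = ((geomT D₀).len y * |cf|⁻¹) ^ 2 := by
  rw [geomT_len, mul_one]
  change ((((ℓ + 1 : ℕ) : ℝ)) ^ y.1.1 / cf) ^ 2 = _
  push_cast
  rw [div_eq_mul_inv, mul_pow, mul_pow, inv_pow, inv_pow, sq_abs]

include hcf in
/-- `len(y)·|c_f|⁻¹ > 0` for `c_f ≠ 0`. [cite: Balaban1984PropagatorsII, (2.1) p.224, dictionary] -/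
theorem len_mul_inv_pos (y : ↥(bset D₀.toDomains)) : 0 < (geomT D₀).len y * |cf|⁻¹ := by
  rw [geomT_len, mul_one]
  have : 0 < |cf| := abs_pos.2 hcf
  positivity

end Inputs

/-! ## §2  THEOREM 3.14 (3.154) AT `U = 1` FOR THE GENUINE `k`-LEVEL `H = GQ*(QGQ*)⁻¹` AND `∇H` ON THE V1 TORUS (assembly) -/

section Main

/-- **[B9] THEOREM 3.14 (3.154) AT `U = 1` FOR `H = GQ*(QGQ*)⁻¹ = GE ∘ QsE ∘ EE (domT hN D hk)` AND `∇_νH` ON THE GENUINE `k`-LEVEL V1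
TORUS.**  There are `δ, C, M₀ > 0` and `N₀` (depending on `d, L, b₀, b₁` only) such that for every V1 torus (`hN`), every TWO nested
families `D, D′ : TDomains` on it with `k ≥ 2` levels, `M_h = L^a ≥ 8`, `R ≥ 2L²`, `P′ ≥ 5L`, `L ≥ 5` odd, placed cubes for both
families, `M₀ ≤ L·M_h`, `N₀ + 1 ≤ R·L·M_h`, every `c_f ≠ 0`, weights `w, w′` in the band (2.16) agreeing on the common index pairs, EVERY
fine bond `f` whose site has both levels `= k` (print's «cube Δ(y), y ∈ Ω^{(k)}», `y(f) = blkV1 hN D f`, `y′(f) = blkV1 hN D′ f` its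
common top block read in the two families), EVERY COMMON TOP index bond `c ∈ 𝔅[D]` (print's «point y′», twin `c̃ = ⟨c.1, _⟩ ∈ 𝔅[D′]`)
and every direction `ν`:
`|(H[Ω]e_c)(f) − (H[Ω′]e_c̃)(f)| ≤ C·e^{−δ·min(d_T(y(f), βc), d_T′(y′(f), β′c̃))}·e^{−δ·d(y(f), βc, Ω)}` and
`|(∇_νH[Ω]e_c)(f) − (∇_νH[Ω′]e_c̃)(f)| ≤ C·(len(y(f))·|c_f|⁻¹)⁻¹·e^{−δ·min(d_T(y(f), βc), d_T′(y′(f), β′c̃))}·e^{−δ·d(y(f), βc, Ω)}` —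
print's «their difference satisfies all the inequalities characteristic for operators of the considered type [(2.151)₁,₂, r03's
`cor28_kLevel_H_DH`: `|(He_c)(f)| ≤ C·e^{−δ₅d_T}`, `|(∇_νHe_c)(f)| ≤ C·(len(y(f))·|c_f|⁻¹)⁻¹·e^{−δ₅d_T}`], with the additional factor
exp(−δ₀d(y, y′, Ω))» for «the cube Δ(y) and the point y′ in the case of H».
[cite: Balaban1985BackgroundPropagators, Thm 3.14 (3.154) pp.426–427; Balaban1984PropagatorsII, Cor. 2.8 (2.150)–(2.151) p.249, Prop. 2.7 (2.149) p.249, (2.136) p.247, Lemma 2.1 (2.60)–(2.61) p.234] -/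
theorem thm314_H_flat_V1 (d ℓ : ℕ) (hd : 1 ≤ d + 1) (hL : Odd (ℓ + 1) ∧ 1 < ℓ + 1) {b₀ b₁ : ℝ} (hb₀ : 0 < b₀) (hb₁ : b₀ ≤ b₁) :
    ∃ δ C M₀ : ℝ, ∃ N₀ : ℕ, 0 < δ ∧ 0 < C ∧ 0 < M₀ ∧
      ∀ (m K : ℕ) {Mh k R : ℕ} {P' : Fin (d + 1) → ℕ}
        (hN : ∀ μ, N0 ℓ Mh k P' μ = (PV d ℓ m K hd hL).sitesPerDir 0) (D D' : TDomains d ℓ Mh k P' R) (hk : k ≤ m + K),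
        2 ≤ k → ∀ {a : ℕ}, Mh = (ℓ + 1) ^ a → 8 ≤ Mh → 2 * (ℓ + 1) ^ 2 ≤ R → (∀ μ, 5 * (ℓ + 1) ≤ P' μ) → 4 ≤ ℓ →
        (∀ c : ↥(cubes D.toDomains), Placed ℓ k P' c.1) → (∀ c : ↥(cubes D'.toDomains), Placed ℓ k P' c.1) →
        M₀ ≤ ((ℓ : ℝ) + 1) * Mh → N₀ + 1 ≤ R * ((ℓ + 1) * Mh) →
        ∀ {cf : ℝ} (hcf : cf ≠ 0) {w : BondIdx (domT hN D hk) → ℝ} (hw : ∀ i, 0 < w i)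
          {w' : BondIdx (domT hN D' hk) → ℝ} (hw' : ∀ i', 0 < w' i'),
        GlobalBand b₀ b₁ cf w → GlobalBand b₀ b₁ cf w' →
        (∀ (i : BondIdx (domT hN D hk)) (i' : BondIdx (domT hN D' hk)), i.1 = i'.1 → w i = w' i') →
        ∀ (f : PBond (PV d ℓ m K hd hL) 0), D.lev (toBox hN f.src).1 = k → D'.lev (toBox hN f.src).1 = k →
        ∀ (c : BondIdx (domT hN D hk)) (hc : IsCT hN D D' hk c.1),
          |(GE (domT hN D hk) hcf hw ∘ₗ QsE (domT hN D hk) ∘ₗ EE (domT hN D hk) hcf hw) (EuclideanSpace.single c (1 : ℝ)) f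
              - (GE (domT hN D' hk) hcf hw' ∘ₗ QsE (domT hN D' hk) ∘ₗ EE (domT hN D' hk) hcf hw')
                  (EuclideanSpace.single (⟨c.1, hc.2.2⟩ : BondIdx (domT hN D' hk)) (1 : ℝ)) f|
            ≤ C * Real.exp (-(δ * min ((geomT D).dist (blkV1 hN D f) (β hN D hk c))
                    ((geomT D').dist (blkV1 hN D' f) (β hN D' hk ⟨c.1, hc.2.2⟩))))
                * Real.exp (-(δ * dOmega D D' (blkV1 hN D f).1.2 (β hN D hk c).1.2)) ∧
          ∀ ν : Fin (d + 1),
          |(DV ν cf ∘ₗ onFun (GE (domT hN D hk) hcf hw ∘ₗ QsE (domT hN D hk) ∘ₗ EE (domT hN D hk) hcf hw)) (Pi.single c 1) f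
              - (DV ν cf ∘ₗ onFun (GE (domT hN D' hk) hcf hw' ∘ₗ QsE (domT hN D' hk) ∘ₗ EE (domT hN D' hk) hcf hw'))
                  (Pi.single (⟨c.1, hc.2.2⟩ : BondIdx (domT hN D' hk)) 1) f|
            ≤ C * ((geomT D).len (blkV1 hN D f) * |cf|⁻¹)⁻¹
                * Real.exp (-(δ * min ((geomT D).dist (blkV1 hN D f) (β hN D hk c))
                    ((geomT D').dist (blkV1 hN D' f) (β hN D' hk ⟨c.1, hc.2.2⟩))))
                * Real.exp (-(δ * dOmega D D' (blkV1 hN D f).1.2 (β hN D hk c).1.2)) := by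
  have hb₁0 : 0 ≤ b₁ := le_trans hb₀.le hb₁
  have hL0 : (0 : ℝ) < (((ℓ + 1 : ℕ) : ℝ)) := by positivity
  -- (2.149) at k levels
  obtain ⟨σ₁, hσ₁, hP27⟩ := prop27_kLevel_unconditional d ℓ hd hL hb₀ hb₁
  obtain ⟨A₁, M₁, c₁, N₁, hA₁, hM₁, hc₁, h27⟩ := hP27 σ₁ hσ₁ le_rfl (1 / 2) (by norm_num) (by norm_num)
  have hγ := gam0_pos d ℓ hb₁0
  have hδ₃ : 0 < delta3 (1 / 2) (2 * σ₁) := delta3_pos (by norm_num) (by linarith)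
  obtain ⟨den, hden⟩ : ∃ den : ℝ, den = 2 * (1 * (4 / delta3 (1 / 2) (2 * σ₁)) * (2 * ((d : ℝ) + 1) * c₁)) + 1 := ⟨_, rfl⟩
  have hden0 : 0 < den := by
    have : 0 ≤ 2 * (1 * (4 / delta3 (1 / 2) (2 * σ₁)) * (2 * ((d : ℝ) + 1) * c₁)) := by positivity
    rw [hden]; linarith
  obtain ⟨δE, hδEdef⟩ : ∃ δE : ℝ, δE = min (delta3 (1 / 2) (2 * σ₁) / 4) (gam0 d ℓ b₁ / A₁ / den) := ⟨_, rfl⟩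
  have hδE : 0 < δE := by
    rw [hδEdef]
    exact lt_min (by positivity) (div_pos (div_pos hγ hA₁) hden0)
  obtain ⟨S, hSdef⟩ : ∃ S : ℝ, S = 2 / gam0 d ℓ b₁ := ⟨_, rfl⟩
  have hS : 0 < S := by rw [hSdef]; positivity
  -- (2.136)₁,₂ at k levels (p38's padded form)
  obtain ⟨σ₃, hσ₃, hP26⟩ := prop26_2136_grad_kLevel_unconditional_pad_V1 d ℓ hd hL hb₀ hb₁
  obtain ⟨A₃, M₃, hA₃, hM₃, h26⟩ := hP26 σ₃ hσ₃ le_rfl (1 / 2) (by norm_num) (by norm_num)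
  have hδG3 : 0 < delta3 (1 / 2) (2 * σ₃) := delta3_pos (by norm_num) (by linarith)
  -- Theorem 3.14 for `G`, `∇G` and for `(QGQ*)⁻¹`
  obtain ⟨δG, CG, MG, NG, hδG, hCG, hMG, hNG, hG⟩ := thm314_G_flat_V1 d ℓ hd hL hb₀ hb₁
  obtain ⟨δG', CG', MG', NG', hδG', hCG', hMG', hNG', hG'⟩ := thm314_gradG_flat_V1 d ℓ hd hL hb₀ hb₁
  obtain ⟨δQ, CQ, MQ, NQ, hδQ, hCQ, hMQ, hQ⟩ := thm314_QGQinv_flat_V1 d ℓ hd hL hb₀ hb₁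
  obtain ⟨CGm, hCGmdef⟩ : ∃ CGm : ℝ, CGm = max CG CG' := ⟨_, rfl⟩
  have hCGm : 0 ≤ CGm := by rw [hCGmdef]; exact hCG.le.trans (le_max_left _ _)
  have hCGle : CG ≤ CGm := by rw [hCGmdef]; exact le_max_left _ _
  have hCG'le : CG' ≤ CGm := by rw [hCGmdef]; exact le_max_right _ _
  -- (2.151)₁,₂ at k levels (r03)
  obtain ⟨σ₅, hσ₅, hP28⟩ := cor28_kLevel_H_DH d ℓ hd hL hb₀ hb₁
  obtain ⟨δ₅, C₅, M₅, N₅, hδ₅, hC₅, hM₅, h28⟩ := hP28 σ₅ hσ₅ le_rfl (1 / 2) (by norm_num) (by norm_num)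
  -- the common rate, the Lemma-2.1 profile and the absorption threshold at that rate
  obtain ⟨δu, hδudef⟩ : ∃ δu : ℝ, δu = min (min δE (delta3 (1 / 2) (2 * σ₃))) (min (min δG δG') (min δQ δ₅)) := ⟨_, rfl⟩
  have hδu : 0 < δu := by rw [hδudef]; exact lt_min (lt_min hδE hδG3) (lt_min (lt_min hδG hδG') (lt_min hδQ hδ₅))
  have hδuE : δu ≤ δE := by rw [hδudef]; exact (min_le_left _ _).trans (min_le_left _ _)
  have hδu3 : δu ≤ delta3 (1 / 2) (2 * σ₃) := by rw [hδudef]; exact (min_le_left _ _).trans (min_le_right _ _)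
  have hδuG : δu ≤ δG := by rw [hδudef]; exact (min_le_right _ _).trans ((min_le_left _ _).trans (min_le_left _ _))
  have hδuG' : δu ≤ δG' := by rw [hδudef]; exact (min_le_right _ _).trans ((min_le_left _ _).trans (min_le_right _ _))
  have hδuQ : δu ≤ δQ := by rw [hδudef]; exact (min_le_right _ _).trans ((min_le_right _ _).trans (min_le_left _ _))
  have hδu5 : δu ≤ δ₅ := by rw [hδudef]; exact (min_le_right _ _).trans ((min_le_right _ _).trans (min_le_right _ _))
  obtain ⟨Nc, c₆, hNc, hc₆, h261⟩ := consts_260_261 d ℓ hδu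
  obtain ⟨N₃, hN₃⟩ : ∃ N₃ : ℕ, N₃ = ⌈2 * ((d : ℝ) + 3) * ((ℓ : ℝ) + 1) / δu⌉₊ + 1 := ⟨_, rfl⟩
  have hN₃ge : 2 * ((d : ℝ) + 3) * ((ℓ : ℝ) + 1) ≤ δu * (N₃ : ℝ) := by
    have h1 : 2 * ((d : ℝ) + 3) * ((ℓ : ℝ) + 1) / δu ≤ (N₃ : ℝ) := by
      rw [hN₃]; push_cast; exact (Nat.le_ceil _).trans (by linarith)
    rw [div_le_iff₀ hδu] at h1; linarith
  -- the constants of the engine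
  obtain ⟨CG0, hCG0def⟩ : ∃ CG0 : ℝ, CG0 = 2 * (((ℓ + 1 : ℕ) : ℝ)) ^ (d + 1) * Real.exp (δu * ((ℓ : ℝ) + 3)) := ⟨_, rfl⟩
  obtain ⟨KS, hKSdef⟩ : ∃ KS : ℝ, KS = CG0 * A₃ * (CQ + S * ((ℓ : ℝ) + 1) ^ (d + 5)) * (2 * ((d : ℝ) + 1) * c₆)
      + S * (2 * (((ℓ + 1 : ℕ) : ℝ)) ^ (d + 1) * CGm + CG0 * A₃ * (2 + ((ℓ : ℝ) + 1) ^ (d + 5))) * (2 * ((d : ℝ) + 1) * c₆) :=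
    ⟨_, rfl⟩
  obtain ⟨E7, hE7def⟩ : ∃ E7 : ℝ, E7 = Real.exp (δu * ((ℓ : ℝ) + 7)) := ⟨_, rfl⟩
  have hCG00 : 0 ≤ CG0 := by rw [hCG0def]; positivity
  have hKS : 0 ≤ KS := by rw [hKSdef]; positivity
  have hE7 : 0 ≤ E7 := by rw [hE7def]; positivity
  refine ⟨δu / 8, Real.sqrt (2 * C₅) * Real.sqrt (KS * E7) + 1, max (max M₁ M₃) (max (max MG MG') (max MQ M₅)),
    max (max N₁ Nc) (max (max NG NG') (max (max NQ N₅) N₃)), by positivity, by positivity,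
    lt_max_of_lt_left (lt_max_of_lt_left hM₁), ?_⟩
  intro m K Mh k R P' hN D D' hk hk2 a hMha hM8 hR hP5L hℓ hplD hplD' hM hNR cf hcf w hw w' hw' hB hB' hww f hfD hfD' c hc
  -- standing side conditions
  have hk1 : 1 ≤ k := le_trans (by norm_num) hk2
  have hMh : 1 ≤ Mh := le_trans (by norm_num) hM8
  have hP5 : ∀ μ, 5 ≤ P' μ := fun μ => le_trans (Nat.le_mul_of_pos_right 5 (Nat.succ_pos ℓ)) (hP5L μ)
  have hP : ∀ μ, 1 ≤ P' μ := fun μ => le_trans (by norm_num) (hP5 μ)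
  have hRM : 2 ≤ R * Mh := two_le_RMh hR hM8
  have hM₁' : M₁ ≤ ((ℓ : ℝ) + 1) * Mh := le_trans ((le_max_left _ _).trans (le_max_left _ _)) hM
  have hM₃' : M₃ ≤ ((ℓ : ℝ) + 1) * Mh := le_trans ((le_max_right _ _).trans (le_max_left _ _)) hM
  have hMG' : MG ≤ ((ℓ : ℝ) + 1) * Mh := le_trans (((le_max_left _ _).trans (le_max_left _ _)).trans (le_max_right _ _)) hM
  have hMG'' : MG' ≤ ((ℓ : ℝ) + 1) * Mh := le_trans (((le_max_right _ _).trans (le_max_left _ _)).trans (le_max_right _ _)) hM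
  have hMQ' : MQ ≤ ((ℓ : ℝ) + 1) * Mh := le_trans (((le_max_left _ _).trans (le_max_right _ _)).trans (le_max_right _ _)) hM
  have hM₅' : M₅ ≤ ((ℓ : ℝ) + 1) * Mh := le_trans (((le_max_right _ _).trans (le_max_right _ _)).trans (le_max_right _ _)) hM
  have hN₁' : N₁ + 1 ≤ R * ((ℓ + 1) * Mh) :=
    le_trans (Nat.succ_le_succ ((le_max_left _ _).trans (le_max_left _ _))) hNR
  have hNc' : Nc + 1 ≤ R * ((ℓ + 1) * Mh) :=
    le_trans (Nat.succ_le_succ ((le_max_right _ _).trans (le_max_left _ _))) hNR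
  have hNG1 : NG + 1 ≤ R * ((ℓ + 1) * Mh) :=
    le_trans (Nat.succ_le_succ (((le_max_left _ _).trans (le_max_left _ _)).trans (le_max_right _ _))) hNR
  have hNG2 : NG' + 1 ≤ R * ((ℓ + 1) * Mh) :=
    le_trans (Nat.succ_le_succ (((le_max_right _ _).trans (le_max_left _ _)).trans (le_max_right _ _))) hNR
  have hNQ' : NQ + 1 ≤ R * ((ℓ + 1) * Mh) :=
    le_trans (Nat.succ_le_succ ((((le_max_left _ _).trans (le_max_left _ _)).trans (le_max_right _ _)).trans
      (le_max_right _ _))) hNR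
  have hN₅' : N₅ + 1 ≤ R * ((ℓ + 1) * Mh) :=
    le_trans (Nat.succ_le_succ ((((le_max_right _ _).trans (le_max_left _ _)).trans (le_max_right _ _)).trans
      (le_max_right _ _))) hNR
  have hN₃' : N₃ + 1 ≤ R * ((ℓ + 1) * Mh) :=
    le_trans (Nat.succ_le_succ (((le_max_right _ _).trans (le_max_right _ _)).trans (le_max_right _ _))) hNR
  have hρ := rho_isPseudoDist hN D hk hMh hP
  have hρ' := rho_isPseudoDist hN D' hk hMh hP
  have hdT := B6Prop23MultiLevelTorus.isPseudoDist_distT D hMh hP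
  have hdT' := B6Prop23MultiLevelTorus.isPseudoDist_distT D' hMh hP
  obtain ⟨hy, hyD', hy', hy'D, hlab⟩ := blkV1_common_top hN D D' f hfD hfD'
  -- (2.149) in the engine's shape, both families, rate lowered to `δu`
  have hE : ∀ a b : BondIdx (domT hN D hk),
      |⟪EuclideanSpace.single a (1 : ℝ), EE (domT hN D hk) hcf hw (EuclideanSpace.single b (1 : ℝ))⟫_ℝ| ≤
        (lam hN D hk cf a)⁻¹ * (lam hN D hk cf b)⁻¹ * (S * Real.exp (-(δu * rho hN D hk a b))) := by
    intro a b
    have h := h27 m K hN D hk hk2 hMha hM8 hR hP5 hℓ hplD hM₁' hN₁' hcf hw hB a b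
    rw [← hden, ← hδEdef, ← hSdef] at h
    exact inner_weaken (inv_nonneg.2 (lam_pos hN D hk hcf a).le) (inv_nonneg.2 (lam_pos hN D hk hcf b).le) hS.le hδuE
      (hρ.nonneg a b) h
  have hE' : ∀ a b : BondIdx (domT hN D' hk),
      |⟪EuclideanSpace.single a (1 : ℝ), EE (domT hN D' hk) hcf hw' (EuclideanSpace.single b (1 : ℝ))⟫_ℝ| ≤
        (lam hN D' hk cf a)⁻¹ * (lam hN D' hk cf b)⁻¹ * (S * Real.exp (-(δu * rho hN D' hk a b))) := by
    intro a b
    have h := h27 m K hN D' hk hk2 hMha hM8 hR hP5 hℓ hplD' hM₁' hN₁' hcf hw' hB' a b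
    rw [← hden, ← hδEdef, ← hSdef] at h
    exact inner_weaken (inv_nonneg.2 (lam_pos hN D' hk hcf a).le) (inv_nonneg.2 (lam_pos hN D' hk hcf b).le) hS.le hδuE
      (hρ'.nonneg a b) h
  -- Theorem 3.14 for `(QGQ*)⁻¹` (file Q3), the plain decay dropped, rate lowered to `δu`
  have hEΔ : ∀ (i : BondIdx (domT hN D hk)) (hi : IsCT hN D D' hk i.1) (i' : BondIdx (domT hN D' hk))
      (hi' : IsCT hN D D' hk i'.1),
      |⟪EuclideanSpace.single i (1 : ℝ), EE (domT hN D hk) hcf hw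
          (EuclideanSpace.single (⟨i'.1, hi'.2.1⟩ : BondIdx (domT hN D hk)) (1 : ℝ))⟫_ℝ
        - ⟪EuclideanSpace.single (⟨i.1, hi.2.2⟩ : BondIdx (domT hN D' hk)) (1 : ℝ), EE (domT hN D' hk) hcf hw'
          (EuclideanSpace.single i' (1 : ℝ))⟫_ℝ|
        ≤ CQ * ((lam hN D hk cf i)⁻¹ * (lam hN D' hk cf i')⁻¹)
          * Real.exp (-(δu * dOmega D D' (β hN D hk i).1.2 (β hN D' hk i').1.2)) := by
    intro i hi i' hi'
    have h := hQ m K hN D D' hk hk2 hMha hM8 hR hP5L hℓ hplD hplD' hMQ' hNQ' hcf hw hw' hB hB' hww i hi i' hi'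
    refine h.trans ?_
    have hW : 0 ≤ CQ * ((lam hN D hk cf i)⁻¹ * (lam hN D' hk cf i')⁻¹) :=
      mul_nonneg hCQ.le (mul_nonneg (inv_nonneg.2 (lam_pos hN D hk hcf i).le) (inv_nonneg.2 (lam_pos hN D' hk hcf i').le))
    have hmin : 0 ≤ min (rho hN D hk i ⟨i'.1, hi'.2.1⟩) (rho hN D' hk ⟨i.1, hi.2.2⟩ i') :=
      le_min (hρ.nonneg _ _) (hρ'.nonneg _ _)
    have h1 : Real.exp (-(δQ * min (rho hN D hk i ⟨i'.1, hi'.2.1⟩) (rho hN D' hk ⟨i.1, hi.2.2⟩ i'))) ≤ 1 := by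
      rw [Real.exp_le_one_iff, neg_nonpos]; exact mul_nonneg hδQ.le hmin
    calc CQ * ((lam hN D hk cf i)⁻¹ * (lam hN D' hk cf i')⁻¹)
          * Real.exp (-(δQ * min (rho hN D hk i ⟨i'.1, hi'.2.1⟩) (rho hN D' hk ⟨i.1, hi.2.2⟩ i')))
          * Real.exp (-(δQ * dOmega D D' (β hN D hk i).1.2 (β hN D' hk i').1.2))
        ≤ CQ * ((lam hN D hk cf i)⁻¹ * (lam hN D' hk cf i')⁻¹) * 1
          * Real.exp (-(δu * dOmega D D' (β hN D hk i).1.2 (β hN D' hk i').1.2)) :=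
          mul_le_mul (mul_le_mul_of_nonneg_left h1 hW) (exp_weaken hδuQ (dOmega_nonneg D D' _ _)) (Real.exp_pos _).le
            (by rw [mul_one]; exact hW)
      _ = _ := by rw [mul_one]
  -- the absorption threshold and the profiles at rate `δu`
  have hN₃le : (N₃ : ℝ) ≤ (R : ℝ) * (((ℓ : ℝ) + 1) * Mh) - 1 := by
    have h2 : ((N₃ + 1 : ℕ) : ℝ) ≤ ((R * ((ℓ + 1) * Mh) : ℕ) : ℝ) := by exact_mod_cast hN₃'
    push_cast at h2; linarith
  have hsmall : ((ℓ : ℝ) + 1) ^ (d + 3) * Real.exp (-(δu / 2 * ((R : ℝ) * (((ℓ : ℝ) + 1) * Mh) - 1))) ≤ 1 :=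
    absorb_threshold hδu hN₃ge hN₃le
  have h261D : Ineq261With c₆ (geomT D) δu (1 / 4) := (h261 k Mh R P' hMh hP hNc').2 D
  have h261D' : Ineq261With c₆ (geomT D') δu (1 / 4) := (h261 k Mh R P' hMh hP hNc').2 D'
  -- the (2.136)₁,₂ majorants and the (2.151)₁,₂ one-family bounds of both families
  have h26D := h26 m K hN D hk hk1 hMha hM8 hR hP5L hℓ hM₃' hcf hw hB
  have h26D' := h26 m K hN D' hk hk1 hMha hM8 hR hP5L hℓ hM₃' hcf hw' hB'
  have h28D := h28 m K hN D hk hk2 hMha hM8 hR hP5 hℓ hplD hM₅' hN₅' hcf hw hB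
  have h28D' := h28 m K hN D' hk hk2 hMha hM8 hR hP5 hℓ hplD' hM₅' hN₅' hcf hw' hB'
  -- the output factors of the common top block of `f`
  have hp := pref_pos D hcf (blkV1 hN D f)
  have hφ := len_mul_inv_pos D hcf (blkV1 hN D f)
  have hΦf : (geomT D').len (blkV1 hN D' f) * |cf|⁻¹ = (geomT D).len (blkV1 hN D f) * |cf|⁻¹ := by
    rw [geomT_len, geomT_len, hy', hy]
  have hpp : pref cf (blkV1 hN D' f) = pref cf (blkV1 hN D f) := by
    rw [pref_eq_len_sq D' cf, pref_eq_len_sq D cf, hΦf]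
  have hr1 : pref cf (blkV1 hN D f) / pref cf (blkV1 hN D f) = 1 := div_self hp.ne'
  have hr2 : (geomT D).len (blkV1 hN D f) * |cf|⁻¹ / pref cf (blkV1 hN D f) = ((geomT D).len (blkV1 hN D f) * |cf|⁻¹)⁻¹ := by
    rw [pref_eq_len_sq D cf, sq, ← div_div, div_self hφ.ne', one_div]
  -- constants and rates of the conclusion (light arithmetic)
  have hm0 : 0 ≤ min ((geomT D).dist (blkV1 hN D f) (β hN D hk c)) ((geomT D').dist (blkV1 hN D' f) (β hN D' hk ⟨c.1, hc.2.2⟩)) :=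
    le_min (hdT.nonneg _ _) (hdT'.nonneg _ _)
  have hdΩ0 := dOmega_nonneg D D' (blkV1 hN D f).1.2 (β hN D hk c).1.2
  have he1 := exp_weaken (div_le_div_of_nonneg_left hδu.le (by norm_num) (by norm_num) : δu / 8 ≤ δu / 4) hm0
  have hC1 : Real.sqrt (2 * C₅) * Real.sqrt (KS * E7) ≤ Real.sqrt (2 * C₅) * Real.sqrt (KS * E7) + 1 :=
    le_add_of_nonneg_right zero_le_one
  have hC0 : 0 ≤ Real.sqrt (2 * C₅) * Real.sqrt (KS * E7) := mul_nonneg (Real.sqrt_nonneg _) (Real.sqrt_nonneg _)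
  have hC10 : 0 ≤ Real.sqrt (2 * C₅) * Real.sqrt (KS * E7) + 1 := add_nonneg hC0 zero_le_one
  have hkey : Real.sqrt (2 * (C₅ * ((geomT D).len (blkV1 hN D f) * |cf|⁻¹)⁻¹))
      * Real.sqrt (KS * ((geomT D).len (blkV1 hN D f) * |cf|⁻¹)⁻¹ * E7)
      = Real.sqrt (2 * C₅) * Real.sqrt (KS * E7) * ((geomT D).len (blkV1 hN D f) * |cf|⁻¹)⁻¹ := by
    have hi : 0 ≤ ((geomT D).len (blkV1 hN D f) * |cf|⁻¹)⁻¹ := inv_nonneg.2 hφ.le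
    rw [show 2 * (C₅ * ((geomT D).len (blkV1 hN D f) * |cf|⁻¹)⁻¹) = 2 * C₅ * ((geomT D).len (blkV1 hN D f) * |cf|⁻¹)⁻¹ by ring,
      show KS * ((geomT D).len (blkV1 hN D f) * |cf|⁻¹)⁻¹ * E7 = KS * E7 * ((geomT D).len (blkV1 hN D f) * |cf|⁻¹)⁻¹ by ring,
      Real.sqrt_mul (mul_nonneg zero_le_two hC₅) _, Real.sqrt_mul (mul_nonneg hKS hE7) _]
    have hs := Real.mul_self_sqrt hi
    calc Real.sqrt (2 * C₅) * Real.sqrt ((geomT D).len (blkV1 hN D f) * |cf|⁻¹)⁻¹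
          * (Real.sqrt (KS * E7) * Real.sqrt ((geomT D).len (blkV1 hN D f) * |cf|⁻¹)⁻¹)
        = Real.sqrt (2 * C₅) * Real.sqrt (KS * E7)
          * (Real.sqrt ((geomT D).len (blkV1 hN D f) * |cf|⁻¹)⁻¹ * Real.sqrt ((geomT D).len (blkV1 hN D f) * |cf|⁻¹)⁻¹) := by
          ring
      _ = _ := by rw [hs]
  refine ⟨?_, fun ν => ?_⟩
  · -- THE ENTRY `|H(b, c)|`: the engine at `T = G`, `Φ = pref`
    have hG1 : HasMajorant (g := geomT D) (blkV1 hN D) (onFun (GE (domT hN D hk) hcf hw))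
        (fun y y' => A₃ * pref cf y * Real.exp (-(δu * (geomT D).dist y y'))) :=
      hasMajorant_weaken hN D (F := fun y => A₃ * pref cf y) (fun y => mul_nonneg hA₃ (pref_nonneg cf y)) hδu3 h26D.1
    have hG1' : HasMajorant (g := geomT D') (blkV1 hN D') (onFun (GE (domT hN D' hk) hcf hw'))
        (fun y y' => A₃ * pref cf y * Real.exp (-(δu * (geomT D').dist y y'))) :=
      hasMajorant_weaken hN D' (F := fun y => A₃ * pref cf y) (fun y => mul_nonneg hA₃ (pref_nonneg cf y)) hδu3 h26D'.1
    have hGΔ : ∀ (y : ↥(bset D.toDomains)) (hyD' : y.1 ∈ bset D'.toDomains) (y' : ↥(bset D'.toDomains))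
        (hy'D : y'.1 ∈ bset D.toDomains), y.1.1 = k → y'.1.1 = k →
        ∀ (μ : PBond (PV d ℓ m K hd hL) 0 → ℝ) (B : ℝ), BlockSupp (g := geomT D') (blkV1 hN D') μ y' B →
        ∀ x : PBond (PV d ℓ m K hd hL) 0, blkV1 hN D x = y →
          |onFun (GE (domT hN D hk) hcf hw) μ x - onFun (GE (domT hN D' hk) hcf hw') μ x|
            ≤ CGm * (pref cf y * B)
              * Real.exp (-(δu * min ((geomT D).dist y ⟨y'.1, hy'D⟩) ((geomT D').dist ⟨y.1, hyD'⟩ y')))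
              * Real.exp (-(δu * dOmega D D' y.1.2 y'.1.2)) :=
      fun y hyD' y' hy'D hy1 hy1' μ B hμ x hx =>
        twoFamily_weaken hCGle hCGm (mul_nonneg (pref_nonneg cf y) hμ.nonneg) hδuG
          (le_min (hdT.nonneg _ _) (hdT'.nonneg _ _)) (dOmega_nonneg D D' _ _)
          (hG m K hN D D' hk hk1 hMha hM8 hR hP5L hℓ hMG' hNG1 hcf hw hw' hB hB' hww y hyD' y' hy'D hy1 hy1' μ B hμ x hx)
    have hH : ∀ a : BondIdx (domT hN D hk),
        |(onFun (GE (domT hN D hk) hcf hw) ∘ₗ onFun (QsE (domT hN D hk) ∘ₗ EE (domT hN D hk) hcf hw)) (Pi.single a 1) f|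
          ≤ C₅ * Real.exp (-(δu * (geomT D).dist (blkV1 hN D f) (β hN D hk a))) := fun a => by
      rw [← H_apply_eq_comp hN D hk hcf hw a f]
      exact (h28D.1 a f).trans (mul_le_mul_of_nonneg_left (exp_weaken hδu5 (hdT.nonneg _ _)) hC₅)
    have hH' : ∀ a' : BondIdx (domT hN D' hk),
        |(onFun (GE (domT hN D' hk) hcf hw') ∘ₗ onFun (QsE (domT hN D' hk) ∘ₗ EE (domT hN D' hk) hcf hw')) (Pi.single a' 1) f|
          ≤ C₅ * Real.exp (-(δu * (geomT D').dist (blkV1 hN D' f) (β hN D' hk a'))) := fun a' => by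
      rw [← H_apply_eq_comp hN D' hk hcf hw' a' f]
      exact (h28D'.1 a' f).trans (mul_le_mul_of_nonneg_left (exp_weaken hδu5 (hdT'.nonneg _ _)) hC₅)
    have H := thm314_TH_of_hyps hN D D' hk hcf hw hw' hk1 hRM hMh hP (Φ := pref cf) (Φ' := pref cf)
      (fun y => pref_nonneg cf y) (fun y => pref_nonneg cf y) hA₃ hS.le hCQ.le hCGm hδu.le hC₅ hG1 hG1' hE hE' hEΔ hGΔ
      hsmall h261D h261D' c hc f hfD hfD' hpp hH hH'
    rw [← hCG0def, ← hKSdef, ← hE7def, hr1, mul_one, ← H_apply_eq_comp hN D hk hcf hw c f,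
      ← H_apply_eq_comp hN D' hk hcf hw' ⟨c.1, hc.2.2⟩ f] at H
    refine H.trans ?_
    exact mul_le_mul (mul_le_mul hC1 he1 (Real.exp_pos _).le hC10) le_rfl (Real.exp_pos _).le
      (mul_nonneg hC10 (Real.exp_pos _).le)
  · -- THE ENTRY `|(∇H)(b, c)|`: the engine at `T = ∇_νG`, `Φ = len·|c_f|⁻¹`
    have hΦ0 : ∀ y : ↥(bset D.toDomains), 0 ≤ (geomT D).len y * |cf|⁻¹ := fun y => (len_mul_inv_pos D hcf y).le
    have hΦ0' : ∀ y : ↥(bset D'.toDomains), 0 ≤ (geomT D').len y * |cf|⁻¹ := fun y => (len_mul_inv_pos D' hcf y).le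
    have hG2 : HasMajorant (g := geomT D) (blkV1 hN D) (DV ν cf ∘ₗ onFun (GE (domT hN D hk) hcf hw))
        (fun y y' => A₃ * ((geomT D).len y * |cf|⁻¹) * Real.exp (-(δu * (geomT D).dist y y'))) :=
      hasMajorant_weaken hN D (F := fun y => A₃ * ((geomT D).len y * |cf|⁻¹)) (fun y => mul_nonneg hA₃ (hΦ0 y)) hδu3
        (h26D.2 ν)
    have hG2' : HasMajorant (g := geomT D') (blkV1 hN D') (DV ν cf ∘ₗ onFun (GE (domT hN D' hk) hcf hw'))
        (fun y y' => A₃ * ((geomT D').len y * |cf|⁻¹) * Real.exp (-(δu * (geomT D').dist y y'))) :=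
      hasMajorant_weaken hN D' (F := fun y => A₃ * ((geomT D').len y * |cf|⁻¹)) (fun y => mul_nonneg hA₃ (hΦ0' y)) hδu3
        (h26D'.2 ν)
    have hG'Δ : ∀ (y : ↥(bset D.toDomains)) (hyD' : y.1 ∈ bset D'.toDomains) (y' : ↥(bset D'.toDomains))
        (hy'D : y'.1 ∈ bset D.toDomains), y.1.1 = k → y'.1.1 = k →
        ∀ (μ : PBond (PV d ℓ m K hd hL) 0 → ℝ) (B : ℝ), BlockSupp (g := geomT D') (blkV1 hN D') μ y' B →
        ∀ x : PBond (PV d ℓ m K hd hL) 0, blkV1 hN D x = y →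
          |(DV ν cf ∘ₗ onFun (GE (domT hN D hk) hcf hw)) μ x - (DV ν cf ∘ₗ onFun (GE (domT hN D' hk) hcf hw')) μ x|
            ≤ CGm * ((geomT D).len y * |cf|⁻¹ * B)
              * Real.exp (-(δu * min ((geomT D).dist y ⟨y'.1, hy'D⟩) ((geomT D').dist ⟨y.1, hyD'⟩ y')))
              * Real.exp (-(δu * dOmega D D' y.1.2 y'.1.2)) :=
      fun y hyD' y' hy'D hy1 hy1' μ B hμ x hx =>
        twoFamily_weaken hCG'le hCGm (mul_nonneg (hΦ0 y) hμ.nonneg) hδuG'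
          (le_min (hdT.nonneg _ _) (hdT'.nonneg _ _)) (dOmega_nonneg D D' _ _)
          (hG' m K hN D D' hk hk1 hMha hM8 hR hP5L hℓ hMG'' hNG2 hcf hw hw' hB hB' hww y hyD' y' hy'D hy1 hy1' μ B hμ ν x hx)
    have hH : ∀ a : BondIdx (domT hN D hk),
        |((DV ν cf ∘ₗ onFun (GE (domT hN D hk) hcf hw)) ∘ₗ onFun (QsE (domT hN D hk) ∘ₗ EE (domT hN D hk) hcf hw))
            (Pi.single a 1) f|
          ≤ C₅ * ((geomT D).len (blkV1 hN D f) * |cf|⁻¹)⁻¹ * Real.exp (-(δu * (geomT D).dist (blkV1 hN D f) (β hN D hk a))) :=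
      fun a => by
      rw [← gradH_apply_eq_comp hN D hk hcf hw ν a f]
      exact ((h28D.2 ν) a f).trans
        (mul_le_mul_of_nonneg_left (exp_weaken hδu5 (hdT.nonneg _ _)) (mul_nonneg hC₅ (inv_nonneg.2 hφ.le)))
    have hH' : ∀ a' : BondIdx (domT hN D' hk),
        |((DV ν cf ∘ₗ onFun (GE (domT hN D' hk) hcf hw')) ∘ₗ onFun (QsE (domT hN D' hk) ∘ₗ EE (domT hN D' hk) hcf hw'))
            (Pi.single a' 1) f|
          ≤ C₅ * ((geomT D).len (blkV1 hN D f) * |cf|⁻¹)⁻¹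
            * Real.exp (-(δu * (geomT D').dist (blkV1 hN D' f) (β hN D' hk a'))) := fun a' => by
      rw [← gradH_apply_eq_comp hN D' hk hcf hw' ν a' f, ← hΦf]
      exact ((h28D'.2 ν) a' f).trans
        (mul_le_mul_of_nonneg_left (exp_weaken hδu5 (hdT'.nonneg _ _)) (mul_nonneg hC₅ (inv_nonneg.2 (hΦf ▸ hφ).le)))
    have H := thm314_TH_of_hyps hN D D' hk hcf hw hw' hk1 hRM hMh hP (Φ := fun y => (geomT D).len y * |cf|⁻¹)
      (Φ' := fun y => (geomT D').len y * |cf|⁻¹) hΦ0 hΦ0' hA₃ hS.le hCQ.le hCGm hδu.le (mul_nonneg hC₅ (inv_nonneg.2 hφ.le))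
      hG2 hG2' hE hE' hEΔ hG'Δ hsmall h261D h261D' c hc f hfD hfD' hΦf hH hH'
    rw [← hCG0def, ← hKSdef, ← hE7def, hr2, hkey, ← gradH_apply_eq_comp hN D hk hcf hw ν c f,
      ← gradH_apply_eq_comp hN D' hk hcf hw' ν ⟨c.1, hc.2.2⟩ f] at H
    refine H.trans ?_
    have hi : 0 ≤ ((geomT D).len (blkV1 hN D f) * |cf|⁻¹)⁻¹ := inv_nonneg.2 hφ.le
    exact mul_le_mul (mul_le_mul (mul_le_mul_of_nonneg_right hC1 hi) he1 (Real.exp_pos _).le (mul_nonneg hC10 hi)) le_rfl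
      (Real.exp_pos _).le (mul_nonneg (mul_nonneg hC10 hi) (Real.exp_pos _).le)

end Main

end Literature.MathematicalPhysics.QuantumFieldTheory.Balaban1983to89.B9Thm314HFlatV1MultiLevelTorus

end
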